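import Summits.RiemannHypothesis.RiemannHypothesis.Theorems.WeilColumnTruncatedWitness
import Summits.RiemannHypothesis.RiemannHypothesis.Theorems.WeilColumnTruncatedTailCut
import Summits.RiemannHypothesis.RiemannHypothesis.Theorems.WeilColumnThetaOddTailNorms
import Summits.RiemannHypothesis.RiemannHypothesis.Theorems.WeilColumnThetaCut
import HarnessLib

/-!
# `∫‖T_R⁻‖² ≤ P.A` for the TRUNCATED odd tail, uniformly in `R` (RH-FREE; PR Steps 5–6 input)

Cell `rh-explicit`, WEIL column, seat handoff-prove-2 gen12.  cc-s2-3's truncated tail `P.TR R = G₀·ψ_R·(1 − χ)` is a tail with the cut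
`χ̃_R = truncCut ψ_R χ` (`WeilColumnTruncatedTailCut.expProfile_mul_step_mul_cut`), `χ̃_R ∈ [0,1]`, `χ̃_R = 1` on `[x₁, ∞)`; hence the
abstract D3 lemma `ThetaTail.integral_norm_sq_oddTail_le` gives, for every `R` and every admissible row,

  **`ThetaParams.integral_norm_sq_TROdd_le (hP : P.Admissible qn) (R) : ∫ x, ‖P.TROdd R x‖² ≤ P.A`**

— the `hA` input of `ThetaParams.re_weilQuadratic_moll_oddTail_le` (`WeilColumnThetaMainTermLevelK`) for `f = P.TROdd R`.
Nothing here bears on the truth of RH.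
-/

noncomputable section

set_option linter.dupNamespace false

open Complex Set MeasureTheory Filter
open scoped Real Topology

namespace Summit.RiemannHypothesis.RiemannHypothesis.Theorems.WeilColumn.ThetaMellin

open Literature.NumberTheory.LFunctions

namespace ThetaParams

variable (P : ThetaParams)

/-- `T_R` as a tail with the cut `χ̃_R = truncCut ψ_R χ`. -/
theorem TR_eq_tail (R x : ℝ) :
    P.TR R x = expProfile P.Θ x * (((1 - truncCut (smoothStep R) P.cut x : ℝ)) : ℂ) := by
  rw [← expProfile_mul_step_mul_cut]
  rfl

/-- **`∫‖T_R⁻‖² ≤ P.A`** for every `R` and every admissible row. [THETA-CERT-cc6 §D3; THETA-ASSIGN §6 Step 5] -/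
theorem integral_norm_sq_TROdd_le {qn : ℕ} (hP : P.Admissible qn) (R : ℝ) : ∫ x, ‖P.TROdd R x‖ ^ 2 ≤ P.A := by
  have hm1 : 1 ≤ P.m := le_trans (by norm_num) hP.three_le
  have hχ01 : ∀ x, truncCut (smoothStep R) P.cut x ∈ Icc (0 : ℝ) 1 :=
    truncCut_mem_Icc (smoothStep_mem_Icc R) (P.cut_mem_Icc hP.eta_pos hm1)
  have hχ1 : ∀ x, P.x₁ ≤ x → truncCut (smoothStep R) P.cut x = 1 :=
    fun x hx ↦ truncCut_eq_one (fun y hy ↦ P.cut_eq_one hP.eta_pos hm1 hy) hx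
  have h := ThetaTail.integral_norm_sq_oddTail_le (Θ := P.Θ) (χ := truncCut (smoothStep R) P.cut) (M := P.M) (m := P.m)
    (P.x₁_neg hP) (rfl : P.u₁ = Real.exp P.x₁) (fun u hu ↦ P.norm_Θ_le' hP hu.1) hχ01 hχ1
  have e : 2 * (P.M ^ 2 * P.u₁ / (2 * P.m + 1)) = P.A := by unfold A; ring
  rw [← e]
  refine le_of_eq_of_le ?_ h
  refine integral_congr_ae (Eventually.of_forall fun x ↦ ?_)
  simp only [TROdd, TR_eq_tail]

end ThetaParams

end Summit.RiemannHypothesis.RiemannHypothesis.Theorems.WeilColumn.ThetaMellin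

end
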